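import Summits.CriticalPhenomena.PercolationContinuityZ3.Theorems.PercNearOneGluingNoHeavyLowerTailAPLThreePointStep
import Summits.CriticalPhenomena.PercolationContinuityZ3.Theorems.PercNearOneGluingNoHeavyLowerTailAPLTreeFourPointAll
import Summits.CriticalPhenomena.PercolationContinuityZ3.Theorems.PercNearOneGluingNoHeavyLowerTailAPLVwTwoLoad
import HarnessLib

/-!
# `NoHeavyLowerTail` (stmt-CriticalPhenomena-4575) — THE THREE-POINT INEQUALITY (★★₃) FOR EVERY FINITE WEIGHTED GRAPH:
# `P(o↔u, o↔b)² + 2·P(o↔u)²P(o↔b)² ≤ 3·P(o↔u)·P(o↔b)·P(u↔b)`, hence `P(o↔u↔b)² ≤ 3·P(o↔u)P(o↔b)P(u↔b)` (Gladkov's constant `8`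
# improved to `3`), gen 51's (★★) `τ² + 3P² ≤ 4Ps`, and the sharp two-load (V_w⁺) on every finite graph

Support file (prover prim-ineq-gen-8 gen 53; `--supports stmt-CriticalPhenomena-4575`; memo
run/shared/lean/prim/prim-ineq-gen-8/FINDING-gen53-THREEPOINT.md).  No definitions, no named facts, no sorries.

`μ = prodBernoulli w` on the pairs of a finite vertex type `V`.  Gen 51 (`…APLVwTwoLoad.lean`) proved that the sharp two-load
inequality (V_w⁺) at `(s; u, b)` is EQUIVALENT to the three-point inequality (★★) `τ² + 3p²π² ≤ 4pπ·μ(u↔b)`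
(`p = μ(s↔u)`, `π = μ(s↔b)`, `τ = μ(s↔u ∩ s↔b)`) and that (★★) implies the Gladkov-type bound `τ² ≤ 4pπ·μ(u↔b)` whose published
constant for general graphs is `8` (Gladkov, arXiv:2408.08457, Thm 6.2; `2` for planar graphs with the three points on one face); it
left (★★) as a conjecture ("Gladkov-4-hard"; 0 violations in 87 000 exact instances, equality on stars).  THIS FILE PROVES the stronger
(★★₃) `τ² + 2p²π² ≤ 3pπ·μ(u↔b)` (also with equality on stars; (★★) follows by adding `p²π² ≤ pπ·μ(u↔b)`):
* **`threePoint_glued`** — (★★₃) for every GLUED APEX SET `S` (`I y := {S ~ y}`, glued connection `G(u,b) := {u↔b} ∪ (I u ∩ I b)`):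
  `μ(I u ∩ I b)² + 2·μ(I u)²μ(I b)² ≤ 3·μ(I u)·μ(I b)·μ(G(u,b))`, by induction on the number of pairs of positive weight exactly as for
  (T3′) (`treeFourPoint_glued`): condition on one pair `s–t` leaving `S` (`real_eq_pin_zero_add_pin_one`), identify the `e`-open endpoint
  with the apex set `S ∪ {t}` (`pin_one_reach/reach3/glued`), and interpolate with the MIXING LEMMA `threePoint_mixture`
  (`…APLThreePointStep.lean`: along the edge `√(P(3s − 2P))` is concave thanks to the cross-row bound `glued_increment_le`, and the
  affine `τ` stays below it); if no live pair leaves `S` both sides are computed by `dead_*`.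
* **`threePoint_all`** — (★★₃) for every finite weighted graph and all `s, u, b` (`S = {s}`); **`threePoint4_all`** — (★★).
* **`gladkov3_all`** — `μ(s↔u ∩ s↔b)² ≤ 3·μ(s↔u)·μ(s↔b)·μ(u↔b)`.
* **`vwPlus_twoLoad_all`** — the sharp two-load (V_w⁺) `W + Φ ≤ 2|Cov(L,R)|` on every finite weighted graph (multiplied by `pπ`, in the
  expanded form of gen 51's `twoLoad_plus_identity`).
[this work]
-/

noncomputable section

namespace Summit.CriticalPhenomena.PercolationContinuityZ3.Theorems

namespace APL

open MeasureTheory Set Literature.Probability.Percolation Literature.Probability.LatticeModels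
open scoped Classical

variable {V : Type*}

/-! ### Small event facts -/

section Events

variable [Fintype V] (w : Sym2 V → unitInterval)

omit [Fintype V] in
/-- The glued reach event `{S ~ x}` is increasing. [folklore] -/
theorem isUpperSet_reach (S : Set V) (x : V) : IsUpperSet (⋃ u ∈ S, (openConn u x : Set (BondConfig V))) := by
  intro ω ω' hle hω
  simp only [mem_iUnion, exists_prop] at hω ⊢
  obtain ⟨u, hu, hux⟩ := hω
  exact ⟨u, hu, isUpperSet_openConn u x hle hux⟩

omit [Fintype V] in
/-- `G_S(y,z) ⊆ G_{S∪t}(y,z)`. [folklore] -/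
theorem glued_subset_insert (S : Set V) (t y z : V) :
    ((openConn y z : Set (BondConfig V)) ∪
        ((⋃ u ∈ S, (openConn u y : Set (BondConfig V))) ∩ (⋃ u ∈ S, (openConn u z : Set (BondConfig V))))) ⊆
      ((openConn y z : Set (BondConfig V)) ∪
        ((⋃ u ∈ insert t S, (openConn u y : Set (BondConfig V))) ∩ (⋃ u ∈ insert t S, (openConn u z : Set (BondConfig V))))) :=
  union_subset_union_right _ (inter_subset_inter (reach_subset_insert S t y) (reach_subset_insert S t z))

/-- Harris for two glued reach events: `μ(I u)·μ(I b) ≤ μ(I u ∩ I b)`. [folklore] -/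
theorem reach_harris (S : Set V) (u b : V) :
    (prodBernoulli w).real (⋃ y ∈ S, (openConn y u : Set (BondConfig V))) *
        (prodBernoulli w).real (⋃ y ∈ S, (openConn y b : Set (BondConfig V))) ≤
      (prodBernoulli w).real ((⋃ y ∈ S, (openConn y u : Set (BondConfig V))) ∩ (⋃ y ∈ S, (openConn y b : Set (BondConfig V)))) :=
  prodBernoulli_harris w (isUpperSet_reach S u) (isUpperSet_reach S b) MeasurableSet.of_discrete MeasurableSet.of_discrete

end Events

/-! ### The induction -/

section Main

variable [Fintype V]

set_option maxHeartbeats 4000000 in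
/-- **(★★) for every glued apex set.**  For every weight function `w`, every finite set `S` of vertices and all `u, b`
(`I y := {S ~ y}`, `G(u,b) := {u↔b} ∪ (I u ∩ I b)`):
`μ(I u ∩ I b)² + 2·(μ(I u)·μ(I b))² ≤ 3·(μ(I u)·μ(I b))·μ(G(u,b))`.
Induction on the number of non-loop pairs of positive weight; the step is `threePoint_mixture`. [this work] -/
theorem threePoint_glued (u b : V) :
    ∀ (n : ℕ) (w : Sym2 V → unitInterval) (S : Finset V),
      (Finset.univ.filter fun f : Sym2 V => ¬ f.IsDiag ∧ 0 < (w f : ℝ)).card = n →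
      (prodBernoulli w).real ((⋃ y ∈ (↑S : Set V), (openConn y u : Set (BondConfig V)))
            ∩ (⋃ y ∈ (↑S : Set V), (openConn y b : Set (BondConfig V)))) ^ 2
        + 2 * ((prodBernoulli w).real (⋃ y ∈ (↑S : Set V), (openConn y u : Set (BondConfig V)))
            * (prodBernoulli w).real (⋃ y ∈ (↑S : Set V), (openConn y b : Set (BondConfig V)))) ^ 2 ≤
      3 * ((prodBernoulli w).real (⋃ y ∈ (↑S : Set V), (openConn y u : Set (BondConfig V)))
            * (prodBernoulli w).real (⋃ y ∈ (↑S : Set V), (openConn y b : Set (BondConfig V))))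
        * (prodBernoulli w).real ((openConn u b : Set (BondConfig V)) ∪
            ((⋃ y ∈ (↑S : Set V), (openConn y u : Set (BondConfig V))) ∩ (⋃ y ∈ (↑S : Set V), (openConn y b : Set (BondConfig V))))) := by
  intro n
  induction n using Nat.strong_induction_on with
  | _ n ih =>
  intro w S hcard
  by_cases hlive : ∃ s ∈ S, ∃ t, t ∉ S ∧ 0 < (w s(s, t) : ℝ)
  · -- (1) a live pair leaving `S`: condition on it
    obtain ⟨s, hs, t, ht, hpos⟩ := hlive
    have hst : s ≠ t := fun h => ht (h ▸ hs)
    have hed : ¬ (s(s, t)).IsDiag := by rwa [Sym2.mk_isDiag_iff]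
    set w0 := pinW w ({s(s, t)} : Set (Sym2 V)) (∅ : Set (Sym2 V)) with hw0
    have hcard0 : (Finset.univ.filter fun f : Sym2 V => ¬ f.IsDiag ∧ 0 < (w0 f : ℝ)).card < n := by
      rw [hw0, support_pin_zero w s(s, t), Finset.card_erase_of_mem, hcard]
      · have : 0 < n := by
          rw [← hcard]
          exact Finset.card_pos.2 ⟨s(s, t), Finset.mem_filter.2 ⟨Finset.mem_univ _, hed, hpos⟩⟩
        omega
      · exact Finset.mem_filter.2 ⟨Finset.mem_univ _, hed, hpos⟩
    have IH0 := ih _ hcard0 w0 S rfl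
    have IH1 := ih _ hcard0 w0 (insert t S) rfl
    rw [Finset.coe_insert] at IH1
    -- the four decompositions `X = (1 - z) X₀ + z X₁`
    have eIu := real_eq_pin_zero_add_pin_one w s(s, t) (⋃ y ∈ (↑S : Set V), (openConn y u : Set (BondConfig V)))
    have eIb := real_eq_pin_zero_add_pin_one w s(s, t) (⋃ y ∈ (↑S : Set V), (openConn y b : Set (BondConfig V)))
    have eT := real_eq_pin_zero_add_pin_one w s(s, t) ((⋃ y ∈ (↑S : Set V), (openConn y u : Set (BondConfig V)))
      ∩ (⋃ y ∈ (↑S : Set V), (openConn y b : Set (BondConfig V))) ∩ (⋃ y ∈ (↑S : Set V), (openConn y b : Set (BondConfig V))))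
    have eG := real_eq_pin_zero_add_pin_one w s(s, t) ((openConn u b : Set (BondConfig V)) ∪
      ((⋃ y ∈ (↑S : Set V), (openConn y u : Set (BondConfig V))) ∩ (⋃ y ∈ (↑S : Set V), (openConn y b : Set (BondConfig V)))))
    rw [pin_one_reach w S hs ht u] at eIu
    rw [pin_one_reach w S hs ht b] at eIb
    rw [pin_one_reach3 w S hs ht u b b] at eT
    rw [pin_one_glued w S hs ht u b] at eG
    -- `I u ∩ I b ∩ I b = I u ∩ I b`
    have e3 : ∀ (A B : Set (BondConfig V)), A ∩ B ∩ B = A ∩ B := fun A B => by rw [inter_assoc, inter_self]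
    rw [e3, e3] at eT
    rw [← hw0] at eIu eIb eT eG
    rw [eIu, eIb, eT, eG]
    -- hypotheses of the mixing lemma
    have hTu0 : (prodBernoulli w0).real ((⋃ y ∈ (↑S : Set V), (openConn y u : Set (BondConfig V)))
        ∩ (⋃ y ∈ (↑S : Set V), (openConn y b : Set (BondConfig V)))) ≤
        (prodBernoulli w0).real (⋃ y ∈ (↑S : Set V), (openConn y u : Set (BondConfig V))) :=
      measureReal_mono inter_subset_left (measure_ne_top _ _)
    have hTu1 : (prodBernoulli w0).real ((⋃ y ∈ insert t (↑S : Set V), (openConn y u : Set (BondConfig V)))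
        ∩ (⋃ y ∈ insert t (↑S : Set V), (openConn y b : Set (BondConfig V)))) ≤
        (prodBernoulli w0).real (⋃ y ∈ insert t (↑S : Set V), (openConn y u : Set (BondConfig V))) :=
      measureReal_mono inter_subset_left (measure_ne_top _ _)
    have hTG0 : (prodBernoulli w0).real ((⋃ y ∈ (↑S : Set V), (openConn y u : Set (BondConfig V)))
        ∩ (⋃ y ∈ (↑S : Set V), (openConn y b : Set (BondConfig V)))) ≤
        (prodBernoulli w0).real ((openConn u b : Set (BondConfig V)) ∪
          ((⋃ y ∈ (↑S : Set V), (openConn y u : Set (BondConfig V))) ∩ (⋃ y ∈ (↑S : Set V), (openConn y b : Set (BondConfig V))))) :=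
      measureReal_mono subset_union_right (measure_ne_top _ _)
    have hTG1 : (prodBernoulli w0).real ((⋃ y ∈ insert t (↑S : Set V), (openConn y u : Set (BondConfig V)))
        ∩ (⋃ y ∈ insert t (↑S : Set V), (openConn y b : Set (BondConfig V)))) ≤
        (prodBernoulli w0).real ((openConn u b : Set (BondConfig V)) ∪
          ((⋃ y ∈ insert t (↑S : Set V), (openConn y u : Set (BondConfig V)))
            ∩ (⋃ y ∈ insert t (↑S : Set V), (openConn y b : Set (BondConfig V))))) :=
      measureReal_mono subset_union_right (measure_ne_top _ _)
    exact threePoint_mixture _ _ _ _ _ _ _ _ _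
      measureReal_nonneg
      (measureReal_mono (reach_subset_insert (↑S : Set V) t u) (measure_ne_top _ _))
      measureReal_nonneg
      (measureReal_mono (reach_subset_insert (↑S : Set V) t b) (measure_ne_top _ _))
      measureReal_nonneg hTu0 hTu1
      (reach_harris w0 (↑S : Set V) u b) (reach_harris w0 (insert t (↑S : Set V)) u b)
      hTG0 hTG1
      (measureReal_mono (glued_subset_insert (↑S : Set V) t u b) (measure_ne_top _ _))
      (glued_increment_le w0 (↑S : Set V) t u b) IH0 IH1 (w s(s, t)).2.1 (w s(s, t)).2.2
  · -- (2) no live pair leaves `S`: the glued set is a.s. isolated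
    push Not at hlive
    have hnull : ∀ y, y ∉ S → (prodBernoulli w).real (⋃ u ∈ (↑S : Set V), (openConn u y : Set (BondConfig V))) = 0 := by
      intro y hy
      have hsub : (⋃ u ∈ (↑S : Set V), (openConn u y : Set (BondConfig V))) ⊆
          {ω : BondConfig V | ∃ i ∈ (Finset.univ.filter fun f : Sym2 V => ∃ s ∈ S, ∃ t, t ∉ S ∧ f = s(s, t)), i ∈ ω} := by
        intro ω hω
        simp only [mem_iUnion, exists_prop] at hω
        obtain ⟨u', hu', huy⟩ := hω
        obtain ⟨s, hs, t, htS, hst⟩ := exists_crossing_of_setConn (S := (↑S : Set V)) (fun h => hy (Finset.mem_coe.1 h)) ⟨u', hu', huy⟩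
        exact ⟨s(s, t), Finset.mem_filter.2 ⟨Finset.mem_univ _, s, Finset.mem_coe.1 hs, t, fun h => htS (Finset.mem_coe.2 h), rfl⟩, hst⟩
      have hle := (measureReal_mono hsub (measure_ne_top _ _)).trans (prodBernoulli_real_exists_mem_le_sum w _)
      have hsum : ∑ i ∈ (Finset.univ.filter fun f : Sym2 V => ∃ s ∈ S, ∃ t, t ∉ S ∧ f = s(s, t)), (w i : ℝ) = 0 := by
        refine Finset.sum_eq_zero fun i hi => ?_
        obtain ⟨s, hs, t, ht, rfl⟩ := (Finset.mem_filter.1 hi).2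
        exact le_antisymm (hlive s hs t ht) (w s(s, t)).2.1
      rw [hsum] at hle
      exact le_antisymm hle measureReal_nonneg
    -- `μ(I u ∩ I b) = [u, b ∈ S]` (from `dead_reach3` with a repeated set)
    have hT : (prodBernoulli w).real ((⋃ y ∈ (↑S : Set V), (openConn y u : Set (BondConfig V)))
        ∩ (⋃ y ∈ (↑S : Set V), (openConn y b : Set (BondConfig V)))) = if (u ∈ S ∧ b ∈ S ∧ b ∈ S) then 1 else 0 := by
      have h3 := dead_reach3 w S hnull u b b
      rwa [inter_assoc, inter_self] at h3
    rw [hT, dead_reach w S hnull u, dead_reach w S hnull b, dead_glued w S hnull u b]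
    by_cases hu : u ∈ S <;> by_cases hb : b ∈ S <;> simp [hu, hb]
    · norm_num

/-- **THE THREE-POINT INEQUALITY (★★₃) FOR EVERY FINITE WEIGHTED GRAPH.**  For all vertices `s, u, b`:
`μ(s↔u ∩ s↔b)² + 2·μ(s↔u)²·μ(s↔b)² ≤ 3·μ(s↔u)·μ(s↔b)·μ(u↔b)`  (equality on every star centred at `s`). [this work] -/
theorem threePoint_all (w : Sym2 V → unitInterval) (s u b : V) :
    (prodBernoulli w).real ((openConn s u : Set (BondConfig V)) ∩ (openConn s b : Set (BondConfig V))) ^ 2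
        + 2 * ((prodBernoulli w).real (openConn s u : Set (BondConfig V))
            * (prodBernoulli w).real (openConn s b : Set (BondConfig V))) ^ 2 ≤
      3 * ((prodBernoulli w).real (openConn s u : Set (BondConfig V)) * (prodBernoulli w).real (openConn s b : Set (BondConfig V)))
        * (prodBernoulli w).real (openConn u b : Set (BondConfig V)) := by
  have h := threePoint_glued u b _ w ({s} : Finset V) rfl
  simp only [Finset.coe_singleton, biUnion_singleton] at h
  have hG : ((openConn u b : Set (BondConfig V)) ∪ (openConn s u ∩ openConn s b : Set (BondConfig V))) =
      (openConn u b : Set (BondConfig V)) := by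
    refine union_eq_self_of_subset_right fun ω hω => ?_
    exact SimpleGraph.Reachable.trans (SimpleGraph.Reachable.symm hω.1) hω.2
  rw [hG] at h
  exact h

/-- **Gen 51's sharp three-point inequality (★★) on every finite weighted graph**: for all `s, u, b`,
`μ(s↔u ∩ s↔b)² + 3·μ(s↔u)²·μ(s↔b)² ≤ 4·μ(s↔u)·μ(s↔b)·μ(u↔b)` — from (★★₃) and `μ(s↔u)μ(s↔b) ≤ μ(s↔u ∩ s↔b) ≤ μ(u↔b)`
(Harris and transitivity).  Equivalent to the sharp two-load (V_w⁺) (`vwPlus_twoLoad_iff_threePoint`). [this work] -/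
theorem threePoint4_all (w : Sym2 V → unitInterval) (s u b : V) :
    (prodBernoulli w).real ((openConn s u : Set (BondConfig V)) ∩ (openConn s b : Set (BondConfig V))) ^ 2
        + 3 * ((prodBernoulli w).real (openConn s u : Set (BondConfig V))
            * (prodBernoulli w).real (openConn s b : Set (BondConfig V))) ^ 2 ≤
      4 * ((prodBernoulli w).real (openConn s u : Set (BondConfig V)) * (prodBernoulli w).real (openConn s b : Set (BondConfig V)))
        * (prodBernoulli w).real (openConn u b : Set (BondConfig V)) := by
  have h3 := threePoint_all w s u b
  have hH : (prodBernoulli w).real (openConn s u : Set (BondConfig V)) * (prodBernoulli w).real (openConn s b : Set (BondConfig V)) ≤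
      (prodBernoulli w).real ((openConn s u : Set (BondConfig V)) ∩ (openConn s b : Set (BondConfig V))) :=
    prodBernoulli_harris w (isUpperSet_openConn s u) (isUpperSet_openConn s b) MeasurableSet.of_discrete MeasurableSet.of_discrete
  have hτs : (prodBernoulli w).real ((openConn s u : Set (BondConfig V)) ∩ (openConn s b : Set (BondConfig V))) ≤
      (prodBernoulli w).real (openConn u b : Set (BondConfig V)) :=
    measureReal_mono (fun ω hω => SimpleGraph.Reachable.trans (SimpleGraph.Reachable.symm hω.1) hω.2) (measure_ne_top _ _)
  have hP0 : 0 ≤ (prodBernoulli w).real (openConn s u : Set (BondConfig V)) * (prodBernoulli w).real (openConn s b : Set (BondConfig V)) :=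
    mul_nonneg measureReal_nonneg measureReal_nonneg
  nlinarith [mul_le_mul_of_nonneg_left (hH.trans hτs) hP0]

/-- **Gladkov-type three-point bound with constant `3` on every finite weighted graph**:
`μ(s↔u ∩ s↔b)² ≤ 3·μ(s↔u)·μ(s↔b)·μ(u↔b)` (i.e. `P(s↔u↔b)² ≤ 3·P(s↔u)P(s↔b)P(u↔b)`; the published constant for general graphs is
`8`, Gladkov, arXiv:2408.08457, Thm 6.2). [this work] -/
theorem gladkov3_all (w : Sym2 V → unitInterval) (s u b : V) :
    (prodBernoulli w).real ((openConn s u : Set (BondConfig V)) ∩ (openConn s b : Set (BondConfig V))) ^ 2 ≤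
      3 * (prodBernoulli w).real (openConn s u : Set (BondConfig V)) * (prodBernoulli w).real (openConn s b : Set (BondConfig V))
        * (prodBernoulli w).real (openConn u b : Set (BondConfig V)) := by
  have h := threePoint_all w s u b
  nlinarith [h, sq_nonneg ((prodBernoulli w).real (openConn s u : Set (BondConfig V))
    * (prodBernoulli w).real (openConn s b : Set (BondConfig V)))]

/-- **The sharp two-load (V_w⁺) on every finite weighted graph.**  For every apex `s`, vertices `u, b` and loads `x, y ≥ 0`
(notation of `…APLVwTwoLoad.lean`: `p = μ(s↔u)`, `π = μ(s↔b)`, `τ = μ(s↔u ∩ s↔b)`, `c = τ − pπ`, `m = μ(u↔b ∩ (s↔u)ᶜ)`):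
`pπ·(W + Φ) ≤ pπ·2|Cov(L,R)|` in the expanded form `π(x(xp(1−p)+yc))² + p(y(yπ(1−π)+xc))² + pπ(x³p(1−p²)+y³π(1−π²))
 ≤ pπ(2x³p(1−p) + 2y³π(1−π) + 2xyc(x+y) + 4xym(xp+yπ))`.  Gen 51 proved the PLAIN (V_w) here from Harris (`twoLoad_vw`) and reduced the
sharp form to (★★) (`twoLoad_plus_identity`, `vwPlus_twoLoad_iff_threePoint`); (★★) is `threePoint4_all`. [this work] -/
theorem vwPlus_twoLoad_all (w : Sym2 V → unitInterval) (s u b : V) (x y : ℝ) (hx : 0 ≤ x) (hy : 0 ≤ y) :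
    (prodBernoulli w).real (openConn s b : Set (BondConfig V)) *
          (x * (x * (prodBernoulli w).real (openConn s u : Set (BondConfig V)) *
                (1 - (prodBernoulli w).real (openConn s u : Set (BondConfig V))) +
              y * ((prodBernoulli w).real ((openConn s u : Set (BondConfig V)) ∩ (openConn s b : Set (BondConfig V))) -
                (prodBernoulli w).real (openConn s u : Set (BondConfig V)) *
                  (prodBernoulli w).real (openConn s b : Set (BondConfig V)))) ^ 2) +
        (prodBernoulli w).real (openConn s u : Set (BondConfig V)) *
          (y * (y * (prodBernoulli w).real (openConn s b : Set (BondConfig V)) *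
                (1 - (prodBernoulli w).real (openConn s b : Set (BondConfig V))) +
              x * ((prodBernoulli w).real ((openConn s u : Set (BondConfig V)) ∩ (openConn s b : Set (BondConfig V))) -
                (prodBernoulli w).real (openConn s u : Set (BondConfig V)) *
                  (prodBernoulli w).real (openConn s b : Set (BondConfig V)))) ^ 2)
        + (prodBernoulli w).real (openConn s u : Set (BondConfig V)) *
            (prodBernoulli w).real (openConn s b : Set (BondConfig V)) *
          (x ^ 3 * (prodBernoulli w).real (openConn s u : Set (BondConfig V)) *
              (1 - (prodBernoulli w).real (openConn s u : Set (BondConfig V)) ^ 2) +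
            y ^ 3 * (prodBernoulli w).real (openConn s b : Set (BondConfig V)) *
              (1 - (prodBernoulli w).real (openConn s b : Set (BondConfig V)) ^ 2))
      ≤ (prodBernoulli w).real (openConn s u : Set (BondConfig V)) *
            (prodBernoulli w).real (openConn s b : Set (BondConfig V)) *
          (2 * x ^ 3 * (prodBernoulli w).real (openConn s u : Set (BondConfig V)) *
                (1 - (prodBernoulli w).real (openConn s u : Set (BondConfig V))) +
              2 * y ^ 3 * (prodBernoulli w).real (openConn s b : Set (BondConfig V)) *
                (1 - (prodBernoulli w).real (openConn s b : Set (BondConfig V))) +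
              2 * x * y * ((prodBernoulli w).real ((openConn s u : Set (BondConfig V)) ∩ (openConn s b : Set (BondConfig V))) -
                (prodBernoulli w).real (openConn s u : Set (BondConfig V)) *
                  (prodBernoulli w).real (openConn s b : Set (BondConfig V))) * (x + y) +
            4 * x * y * (prodBernoulli w).real ((openConn u b : Set (BondConfig V)) ∩ (openConn s u : Set (BondConfig V))ᶜ) *
              (x * (prodBernoulli w).real (openConn s u : Set (BondConfig V)) +
                y * (prodBernoulli w).real (openConn s b : Set (BondConfig V)))) := by
  have hstar := threePoint4_all w s u b
  have hs := real_openConn_eq_tau_add_off w s u b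
  set μ := prodBernoulli w with hμ
  set p := μ.real (openConn s u : Set (BondConfig V)) with hp'
  set π := μ.real (openConn s b : Set (BondConfig V)) with hπ'
  set τ := μ.real ((openConn s u : Set (BondConfig V)) ∩ (openConn s b : Set (BondConfig V))) with hτ
  set m := μ.real ((openConn u b : Set (BondConfig V)) ∩ (openConn s u : Set (BondConfig V))ᶜ) with hm
  rw [hs] at hstar
  have hstar' : τ ^ 2 + 3 * p ^ 2 * π ^ 2 ≤ 4 * p * π * (τ + m) := by
    have e1 : 3 * p ^ 2 * π ^ 2 = 3 * (p * π) ^ 2 := by ring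
    have e2 : 4 * p * π * (τ + m) = 4 * (p * π) * (τ + m) := by ring
    rw [e1, e2]; exact hstar
  have hp0 : 0 ≤ p := measureReal_nonneg
  have hπ0 : 0 ≤ π := measureReal_nonneg
  -- the pair coefficient is non-positive
  have hcoef : (τ - p * π) ^ 2 - 2 * p * π * (τ - p * π) - 4 * p * π * m ≤ 0 :=
    (vwPlus_twoLoad_iff_threePoint p π τ m).2 hstar'
  have hid := twoLoad_plus_identity p π (τ - p * π) m x y
  have hM : 0 ≤ x * y * (p * x + π * y) := by positivity
  have hprod : ((τ - p * π) ^ 2 - 2 * p * π * (τ - p * π) - 4 * p * π * m) * (x * y * (p * x + π * y)) ≤ 0 :=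
    mul_nonpos_of_nonpos_of_nonneg hcoef hM
  rw [← hid] at hprod
  linarith

end Main

end APL

end Summit.CriticalPhenomena.PercolationContinuityZ3.Theorems

end
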